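import Summits.QuantumFields.QCD.Theorems.QuarksAsStableActionStableActionBridgeStubRpOfSymThermal
import Literature.MathematicalPhysics.QuantumFieldTheory.SchwingerLimitInheritance
import HarnessLib

/-!
# Stub `stub_rpOfComparison` of line `birth`
(crux `Summit.QuantumFields.QCD.Theses.GapBuysCauchyRate.ConvergentOSClosure`, item stmt-QuantumFields-11525,
route route-QuantumFields-GapBuysCauchyRate)

## Summary

Eventually approximately positive Osterwalder–Schrader forms (clause P8 of the lattice package of the sibling crux
`StableActionBridge`, stmt-QuantumFields-9737) for the canonical lattice distributions `qcdLatticeDist sch k` of the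
time-PERIODIC own-torus functional, from three inputs:

* P2 — a k-uniform E0′ bound `‖qcdLatticeDist sch k n σ F‖ ≤ α (n!)^β |F|_{ns}` on `⁰𝒮`, eventually in `k`;
* COMP — the E0′-norm comparison periodic ↔ Θ-symmetrised thermal distributions: for every `ε > 0`, eventually in `k`,
  `‖qcdLatticeDistSymAP sch k n σ F − qcdLatticeDist sch k n σ F‖ ≤ ε |F|_{ns}` on `⁰𝒮`;
* the landed theorem `stub_rpOfSymThermal` (`Theorems/QuarksAsStableActionStableActionBridgeStubRpOfSymThermal.lean`):
  P8 for the thermal Θ-symmetrised distributions `qcdLatticeDistSymAP` under an E0′ bound for them.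

Proof.  (1) P2 and COMP at `ε = 1` give the E0′ bound `(α + 1) (n!)^{max β 0} |F|_{ns}` for `qcdLatticeDistSymAP`
(`1 ≤ n!`, monotonicity of `rpow` in the exponent).  (2) `stub_rpOfSymThermal` at `ε / 2` gives, eventually in `l`,
`re ≥ −ε/2` and `|im| ≤ ε/2` for the symmetrised OS form of the finite time-ordered family.  (3) Every witness `H i j`
of `ΘGᵢ* ⊗ Gⱼ` is off-diagonal (`IsAppendTensorOf.isOffDiagonal_of_isTimeOrdered`), so COMP at
`ε' = ε / (2 (M + 1))`, `M = ∑ᵢⱼ |H i j|`, intersected over the finitely many pairs, bounds the difference of the two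
OS forms by `ε' M ≤ ε / 2` eventually; `|re z|, |im z| ≤ ‖z‖` finishes.

References: Osterwalder–Schrader, CMP 31 (1973) §2 (E2); Glimm–Jaffe, *Quantum Physics* (1987) §6.1.
No definitions, no named facts.
-/

noncomputable section

open scoped BigOperators Topology SchwartzMap ComplexConjugate
open MeasureTheory Filter
open Literature.MathematicalPhysics.AQFT Literature.MathematicalPhysics.QuantumLattice
  Literature.MathematicalPhysics.QuantumFieldTheory
open Summit.QuantumFields.QCD.Cruxes.StableActionBridge.Sketch

namespace Summit.QuantumFields.QCD.Theorems.ConvergentOSClosure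

/-- **Approximate positivity passes across a small perturbation of a finite double sum.**  If the entries
`P i j`, `S i j` of two finite square arrays of complex numbers differ by at most `c * w i j` in norm, with
`c * ∑ᵢⱼ w i j ≤ ε / 2`, and the double sum of `P` has real part `≥ −ε/2` and imaginary part `≤ ε/2` in modulus,
then the double sum of `S` has real part `≥ −ε` and imaginary part `≤ ε` in modulus
(`|re z| ≤ ‖z‖`, `|im z| ≤ ‖z‖`, `norm_sum_le`). -/
private theorem sum_re_im_of_near {ι : Type*} [Fintype ι] (P S : ι → ι → ℂ) (w : ι → ι → ℝ) {ε c : ℝ}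
    (hc : c * ∑ i, ∑ j, w i j ≤ ε / 2) (hd : ∀ i j, ‖P i j - S i j‖ ≤ c * w i j)
    (hre : -(ε / 2) ≤ (∑ i, ∑ j, P i j).re) (him : |(∑ i, ∑ j, P i j).im| ≤ ε / 2) :
    -ε ≤ (∑ i, ∑ j, S i j).re ∧ |(∑ i, ∑ j, S i j).im| ≤ ε := by
  have herr : ‖(∑ i, ∑ j, P i j) - ∑ i, ∑ j, S i j‖ ≤ ε / 2 := by
    have hdiff : (∑ i, ∑ j, P i j) - ∑ i, ∑ j, S i j = ∑ i, ∑ j, (P i j - S i j) := by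
      simp only [Finset.sum_sub_distrib]
    rw [hdiff]
    calc ‖∑ i, ∑ j, (P i j - S i j)‖ ≤ ∑ i, ‖∑ j, (P i j - S i j)‖ := norm_sum_le _ _
      _ ≤ ∑ i, ∑ j, ‖P i j - S i j‖ := Finset.sum_le_sum fun i _ => norm_sum_le _ _
      _ ≤ ∑ i, ∑ j, c * w i j := Finset.sum_le_sum fun i _ => Finset.sum_le_sum fun j _ => hd i j
      _ = c * ∑ i, ∑ j, w i j := by simp only [Finset.mul_sum]
      _ ≤ ε / 2 := hc
  have hre' : ((∑ i, ∑ j, P i j) - ∑ i, ∑ j, S i j).re ≤ ‖(∑ i, ∑ j, P i j) - ∑ i, ∑ j, S i j‖ :=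
    Complex.re_le_norm _
  have him' : |((∑ i, ∑ j, P i j) - ∑ i, ∑ j, S i j).im| ≤ ‖(∑ i, ∑ j, P i j) - ∑ i, ∑ j, S i j‖ :=
    Complex.abs_im_le_norm _
  rw [Complex.sub_re] at hre'
  rw [Complex.sub_im] at him'
  obtain ⟨h1, h2⟩ := abs_le.1 him
  obtain ⟨h3, h4⟩ := abs_le.1 him'
  exact ⟨by linarith, abs_le.2 ⟨by linarith, by linarith⟩⟩

/-- **From an E0′ bound and a norm comparison to an E0′ bound** (step (1)): if eventually
`‖D F‖ ≤ α (n!)^β |F|` with `0 ≤ α` and `‖D' F − D F‖ ≤ |F|` on a class of test functions, then eventually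
`‖D' F‖ ≤ (α + 1) (n!)^{max β 0} |F|` on that class (`1 ≤ n!`, so `(n!)^β ≤ (n!)^{max β 0}` and
`1 ≤ (n!)^{max β 0}`). -/
private theorem symBound_of_bound_of_comparison {Nf : ℕ} (sch : QCDScheme Nf) {s : ℕ} {α β : ℝ} (hα : 0 ≤ α)
    (hP2 : ∀ (n : ℕ) (σ : Fin n → QCDField Nf), ∀ᶠ k in Filter.atTop,
      ∀ F : SchwartzMap (Fin n → EuclideanSpace ℝ (Fin 4)) ℂ, IsOffDiagonal F →
        ‖qcdLatticeDist sch k n σ F‖ ≤ α * (n.factorial : ℝ) ^ β * schwartzNorm (n * s) F)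
    (hC1 : ∀ (n : ℕ) (σ : Fin n → QCDField Nf), ∀ᶠ k in Filter.atTop,
      ∀ F : SchwartzMap (Fin n → EuclideanSpace ℝ (Fin 4)) ℂ, IsOffDiagonal F →
        ‖qcdLatticeDistSymAP sch k n σ F - qcdLatticeDist sch k n σ F‖ ≤ 1 * schwartzNorm (n * s) F) :
    ∀ (n : ℕ) (σ : Fin n → QCDField Nf), ∀ᶠ k in Filter.atTop,
      ∀ F : SchwartzMap (Fin n → EuclideanSpace ℝ (Fin 4)) ℂ, IsOffDiagonal F →
        ‖qcdLatticeDistSymAP sch k n σ F‖ ≤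
          (α + 1) * (n.factorial : ℝ) ^ (max β 0) * schwartzNorm (n * s) F := by
  intro n σ
  filter_upwards [hP2 n σ, hC1 n σ] with k hk hk' F hF
  have h1 : (1 : ℝ) ≤ (n.factorial : ℝ) := by exact_mod_cast Nat.succ_le_of_lt n.factorial_pos
  have h2 : (n.factorial : ℝ) ^ β ≤ (n.factorial : ℝ) ^ (max β 0) :=
    Real.rpow_le_rpow_of_exponent_le h1 (le_max_left _ _)
  have h3 : (1 : ℝ) ≤ (n.factorial : ℝ) ^ (max β 0) := Real.one_le_rpow h1 (le_max_right _ _)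
  have h0 : 0 ≤ schwartzNorm (n * s) F := schwartzNorm_nonneg _ _
  calc ‖qcdLatticeDistSymAP sch k n σ F‖
      ≤ ‖qcdLatticeDist sch k n σ F‖ + ‖qcdLatticeDistSymAP sch k n σ F - qcdLatticeDist sch k n σ F‖ :=
        norm_le_norm_add_norm_sub' _ _
    _ ≤ α * (n.factorial : ℝ) ^ β * schwartzNorm (n * s) F + 1 * schwartzNorm (n * s) F :=
        add_le_add (hk F hF) (hk' F hF)
    _ ≤ α * (n.factorial : ℝ) ^ (max β 0) * schwartzNorm (n * s) F +
          (n.factorial : ℝ) ^ (max β 0) * schwartzNorm (n * s) F := by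
        apply add_le_add
        · exact mul_le_mul_of_nonneg_right (mul_le_mul_of_nonneg_left h2 hα) h0
        · rw [one_mul]; exact le_mul_of_one_le_left h0 h3
    _ = (α + 1) * (n.factorial : ℝ) ^ (max β 0) * schwartzNorm (n * s) F := by ring

/-- **The lead's registered stub `stub_rpOfComparison` (RP-b): P2 + the periodic ↔ thermal E0′-norm comparison +
the landed `stub_rpOfSymThermal` ⇒ P8 for the canonical lattice distributions `qcdLatticeDist`.**
Along a scheme with eventually physical couplings (`0 ≤ β_k`, `−1 < m_q(k)`), a k-uniform E0′ bound on `⁰𝒮` for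
`qcdLatticeDist sch k` (P2) and the E0′-norm comparison `‖Λ^{AP,sym}_k F − Λ_k F‖ ≤ ε |F|_{ns}` eventually in `k`
for every `ε > 0` (COMP) imply: every finite time-ordered family has OS forms of `qcdLatticeDist sch l` with real part
`≥ −ε` and imaginary part `≤ ε` in modulus, eventually in `l`.  Proof: COMP at `ε = 1` upgrades P2 to an E0′ bound
for the symmetrised thermal distributions, `stub_rpOfSymThermal` gives their approximate positivity at `ε/2`, and COMP
at `ε / (2 (M + 1))`, `M = ∑ᵢⱼ |H i j|_{(degᵢ+degⱼ)s}`, over the finitely many off-diagonal witnesses `H i j`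
(`IsAppendTensorOf.isOffDiagonal_of_isTimeOrdered`) moves it to the periodic forms up to `ε/2`.
[difficulty: M] [cite: OsterwalderSchraderCMP1973, §2 (E2)] -/
theorem stub_rpOfComparison : ∀ (Nf : ℕ) (sch : QCDScheme Nf), (∀ᶠ k in Filter.atTop, 0 ≤ sch.β k) → (∀ fl : Fin Nf, ∀ᶠ k in Filter.atTop, -1 < sch.mq fl k) → ∀ (s : ℕ) (α β : ℝ), 0 ≤ α → (∀ (n : ℕ) (σ : Fin n → QCDField Nf), ∀ᶠ k in Filter.atTop, ∀ F : SchwartzMap (Fin n → EuclideanSpace ℝ (Fin 4)) ℂ, IsOffDiagonal F → ‖qcdLatticeDist sch k n σ F‖ ≤ α * (n.factorial : ℝ) ^ β * schwartzNorm (n * s) F) → (∀ ε : ℝ, 0 < ε → ∀ (n : ℕ) (σ : Fin n → QCDField Nf), ∀ᶠ k in Filter.atTop, ∀ F : SchwartzMap (Fin n → EuclideanSpace ℝ (Fin 4)) ℂ, IsOffDiagonal F → ‖qcdLatticeDistSymAP sch k n σ F - qcdLatticeDist sch k n σ F‖ ≤ ε * schwartzNorm (n * s) F) → (∀ (N : ℕ)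 (deg : Fin N → ℕ) (lab : (j : Fin N) → Fin (deg j) → QCDField Nf) (G : (j : Fin N) → SchwartzMap (Fin (deg j) → EuclideanSpace ℝ (Fin 4)) ℂ), (∀ j, IsTimeOrdered (G j)) → ∀ H : (i j : Fin N) → SchwartzMap (Fin (deg i + deg j) → EuclideanSpace ℝ (Fin 4)) ℂ, (∀ i j, IsAppendTensorOf (H i j) (osAdjoint (G i)) (G j)) → ∀ ε : ℝ, 0 < ε → ∀ᶠ l in Filter.atTop, -ε ≤ (∑ i, ∑ j, qcdLatticeDist sch l (deg i + deg j) (Fin.append (lab i ∘ Fin.rev) (lab j)) (H i j)).re ∧ |(∑ i, ∑ j, qcdLatticeDist sch l (deg i + deg j) (Fin.append (lab i ∘ Fin.rev) (lab j)) (H i j)).im| ≤ ε) := by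
  intro Nf sch hβ hbr s α β hα hP2 hcomp N deg lab G hG H hH ε hε
  classical
  -- (1) the E0′ bound for the symmetrised thermal distributions, (2) their approximate positivity at `ε / 2`
  have hbSym := symBound_of_bound_of_comparison sch hα hP2 (hcomp 1 one_pos)
  have hsym := stub_rpOfSymThermal sch hβ hbr hbSym N deg lab G hG H hH (ε / 2) (half_pos hε)
  -- (3) the comparison over the finitely many off-diagonal witnesses
  have hHo : ∀ i j, IsOffDiagonal (H i j) := fun i j =>
    (hH i j).isOffDiagonal_of_isTimeOrdered (hG i) (hG j)
  obtain ⟨M, hMdef⟩ : ∃ M : ℝ, M = ∑ i, ∑ j, schwartzNorm ((deg i + deg j) * s) (H i j) := ⟨_, rfl⟩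
  have hM0 : 0 ≤ M :=
    hMdef ▸ Finset.sum_nonneg fun i _ => Finset.sum_nonneg fun j _ => schwartzNorm_nonneg _ _
  have hε' : 0 < ε / (2 * (M + 1)) := by positivity
  have hcM : ε / (2 * (M + 1)) * ∑ i, ∑ j, schwartzNorm ((deg i + deg j) * s) (H i j) ≤ ε / 2 := by
    rw [← hMdef]
    calc ε / (2 * (M + 1)) * M ≤ ε / (2 * (M + 1)) * (M + 1) :=
          mul_le_mul_of_nonneg_left (by linarith) hε'.le
      _ = ε / 2 := by
          field_simp
      _ ≤ ε / 2 := le_rfl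
  have hnear : ∀ᶠ l in Filter.atTop, ∀ i j,
      ‖qcdLatticeDistSymAP sch l (deg i + deg j) (Fin.append (lab i ∘ Fin.rev) (lab j)) (H i j) -
          qcdLatticeDist sch l (deg i + deg j) (Fin.append (lab i ∘ Fin.rev) (lab j)) (H i j)‖ ≤
        ε / (2 * (M + 1)) * schwartzNorm ((deg i + deg j) * s) (H i j) := by
    refine eventually_all.2 fun i => eventually_all.2 fun j => ?_
    filter_upwards [hcomp _ hε' (deg i + deg j) (Fin.append (lab i ∘ Fin.rev) (lab j))] with l hl
    exact hl (H i j) (hHo i j)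
  filter_upwards [hsym, hnear] with l hl hl'
  exact sum_re_im_of_near
    (fun i j => qcdLatticeDistSymAP sch l (deg i + deg j) (Fin.append (lab i ∘ Fin.rev) (lab j)) (H i j))
    (fun i j => qcdLatticeDist sch l (deg i + deg j) (Fin.append (lab i ∘ Fin.rev) (lab j)) (H i j))
    (fun i j => schwartzNorm ((deg i + deg j) * s) (H i j)) hcM hl' hl.1 hl.2

end Summit.QuantumFields.QCD.Theorems.ConvergentOSClosure

end
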